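import Summits.QuantumFields.YangMills.Theorems.BalabanUVNodesPortS1LZdetPiecesAnalytic
import Summits.QuantumFields.YangMills.Theorems.BalabanUVNodesPortS1LZdetGermMem
import Summits.QuantumFields.YangMills.Theorems.BalabanUVNodesPortS1LZdetGerm
import Summits.QuantumFields.YangMills.Theorems.BalabanUVNodesPortS1LZdetPiecesLocGauge
import Summits.QuantumFields.YangMills.Theorems.BalabanUVNodesPortS1LZdetPack
import Summits.QuantumFields.YangMills.Theorems.BalabanUVNodesPortS1G3CDefs
import Summits.QuantumFields.YangMills.Theorems.BalabanUVNodesPortS1UnitSubtraction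

/-!
# NODE O port PT-A — THE ASSEMBLY OF THE GAUSSIAN SUB-HALF AT FIXED CARRIERS (v3.4∕v3.5 glue `stub_LZdetGlue` of 27930, line `pta_residueW`): from the P0-ℂ body `P0CarrierClauses`, the
# resummed resolvent pieces `G3CPiecesAt`, and an integer twin `ΨP` of the power member ⟹ `∃ Ψ Ew, Ψ.ResidueAtW … E₁ κ (phiLZdet F Mc a₀ ε₂₉ k)` with
# `E₁ = 2·13·4⁴·(R·Bc + 12(L·Mc)⁴)`, `κ = min κt (δ₀∕2) − 2`

Cell `ym-nodeO-ideate`, porter seat `ymgap-nodeO-port-PTA-1` (gen 8); `--supports stmt-QuantumFields-27930` (helper, P0-free).  [I] = [Balaban1987RG1], [16] = [Balaban1985UV3], [15] = [Balaban1985Variational].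
THE PIECES (all ✓, this lineage gens 7–8): objects ✓`…LZdetPiecesDefs` (`lzdetPiece`, `lzdetTorusPieces`); germ identity ✓`…LZdetGerm.eventually_phiLZdet_eq_sum_lzdetPiece` ([16] (63) on `[0, R]`); row (a)
✓`…LZdetPiecesAnalytic.analyticAt_lzdetPiece`; row (b) ✓`…LZdetPiecesBound.norm_lzdetPiece_le`; rows (c)(d) ✓`…LZdetPiecesLocGauge`; germ membership ✓`…LZdetGermMem`; geometry ✓`…LZdetGeom`
(antitone spaces, cube map, per-cube count); packaging ✓`…LZdetPack.residueAtW_of_piecesJ`.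
THIS FILE: §1 the integer formula of the Gaussian bracket `Ψ_LZdet := [½∫₀^R EGZ(x) dx + ΨP] − [same at the unit configuration]` as an `IntLocalFormula` (window-locality and `SL(2,ℂ)`-invariance
from (gZ) and `ΨP`'s; unit subtraction ✓`…UnitSubtraction`), its pull-back pieces = `lzdetTorusPieces` OFF the wrap class; §2 ★★★ `lzdetResidue_of_carriers` — the wrap-aware residue of `phiLZdet` at fixed `(Mc, k, a₀, ε₂₉, α₀, α₁)` and
fixed carriers, with the k-UNIFORM constants `E₁ = 2·13·4⁴·(R·Bc + 12(L·Mc)⁴)`, `κ = min κt (δ₀∕2) − 2` (thresholds: `κ₀(64,8) ≤ δ₀∕2 − 1`, `2γ₁ ≤ R`, `16c₀·(64K₀(64,8))·e^{δ₀} ≤ R`).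
The letter-level walks (`PowMemberIntTwin F → P0HolExtAtRecordG[L] F → G3CAtRecord[L] F → PortRecordLZdetHalf F`) are one `obtain` chain over this theorem (companion file `…LZdetGlue`).

HONEST FRAMING.  Composition of the tree's own theorems at DISPLAYED hypotheses (the P0-ℂ body, the G3C pieces, the power member's integer twin — OPEN letters, inhabited nowhere); NOTHING of
Bałaban's estimates asserted, ported or discharged; `stub_P0C` ∕ `stub_G3C` ∕ `stub_LZdetGlue` ∕ `stub_FE` OPEN; 27930 OPEN (2∕6 stubs by name) · no claim; NODE O 0∕1; COUNT 8∕28 · K 1∕4 UNMOVED;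
finite `𝕋⁴_{L^K}` at fixed ε — NOT continuum ∕ OS ∕ Clay; **the Yang–Mills mass gap is NOT proved by any of this.**  No `sorry`, no `def`, no `instance`, no `notation`; standard axioms.
-/

noncomputable section

open scoped BigOperators Matrix.Norms.L2Operator Topology
open Filter Finset

namespace Summit.QuantumFields.YangMills.Theorems.BalabanUVNodesPortS1

open Summit.QuantumFields.YangMills.Theorems.K0RecordFormatNames
open Literature.MathematicalPhysics.QuantumFieldTheory.Balaban1983to89
open Literature.MathematicalPhysics.QuantumFieldTheory.Balaban1983to89.Node00
open Literature.MathematicalPhysics.QuantumFieldTheory.Balaban1983to89.T4Continuum (T4Family)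
open Literature.MathematicalPhysics.QuantumFieldTheory.Balaban1983to89.TreeLengthTorus
open Literature.MathematicalPhysics.QuantumFieldTheory.Balaban1983to89.B12TreeDecay (K₀ kappa₀)

variable (F : T4Family)

/-! ## §1  The integer formula of the Gaussian bracket -/

section IntFormula

/-- **Window-locality of `½∫₀^R EGZ(x) dx + ΨP`** from (gZ)'s locality of every `EGZ(x)`, `x ≥ 0`, and `ΨP`'s (`R ≥ 0`). [cite: Balaban1987RG1, (1.7) p.261, (1.21) p.264] -/
theorem isLocal_lzdetGFormula {s : ℕ} (EGZ : ℝ → IntFormula) (ΨP : IntLocalFormula s) {R : ℝ} (hR : 0 ≤ R)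
    (hZ : ∀ x : ℝ, 0 ≤ x → (EGZ x).IsLocal s) :
    IntFormula.IsLocal s fun Xh f => (1 / 2 : ℂ) * (∫ x in (0 : ℝ)..R, EGZ x Xh f) + ΨP.Ψ Xh f := by
  intro Xh f f' hff'
  have hint : (∫ x in (0 : ℝ)..R, EGZ x Xh f) = ∫ x in (0 : ℝ)..R, EGZ x Xh f' :=
    intervalIntegral.integral_congr fun x hx => by
      rw [Set.uIcc_of_le hR] at hx
      exact hZ x hx.1 Xh f f' hff'
  show (1 / 2 : ℂ) * (∫ x in (0 : ℝ)..R, EGZ x Xh f) + ΨP.Ψ Xh f = (1 / 2 : ℂ) * (∫ x in (0 : ℝ)..R, EGZ x Xh f') + ΨP.Ψ Xh f'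
  rw [hint, ΨP.isLocal Xh f f' hff']

/-- **`SL(2,ℂ)`-invariance of `½∫₀^R EGZ(x) dx + ΨP`** from (gZ)'s invariance of every `EGZ(x)`, `x ≥ 0`, and `ΨP`'s (`R ≥ 0`). [cite: Balaban1987RG1, (1.19) p.263, (1.10) p.262] -/
theorem isGaugeInv_lzdetGFormula {s : ℕ} (EGZ : ℝ → IntFormula) (ΨP : IntLocalFormula s) {R : ℝ} (hR : 0 ≤ R)
    (hZ : ∀ x : ℝ, 0 ≤ x → (EGZ x).IsGaugeInv) :
    IntFormula.IsGaugeInv fun Xh f => (1 / 2 : ℂ) * (∫ x in (0 : ℝ)..R, EGZ x Xh f) + ΨP.Ψ Xh f := by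
  intro Xh û hû f
  have hint : (∫ x in (0 : ℝ)..R, EGZ x Xh (intGaugeAct û f)) = ∫ x in (0 : ℝ)..R, EGZ x Xh f :=
    intervalIntegral.integral_congr fun x hx => by
      rw [Set.uIcc_of_le hR] at hx
      exact hZ x hx.1 Xh û hû f
  show (1 / 2 : ℂ) * (∫ x in (0 : ℝ)..R, EGZ x Xh (intGaugeAct û f)) + ΨP.Ψ Xh (intGaugeAct û f) = (1 / 2 : ℂ) * (∫ x in (0 : ℝ)..R, EGZ x Xh f) + ΨP.Ψ Xh f
  rw [hint]
  congr 1
  exact ΨP.isGaugeInv Xh û hû f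

end IntFormula

/-! ## §2  ★★★ The wrap-aware residue of `phiLZdet` at fixed carriers -/

section Assembly

open scoped Classical in
/-- ★★★ **THE GAUSSIAN SUB-HALF AT FIXED CARRIERS.**  At an admissible `Mc`, a level `k`, letters `a₀ ε₂₉ α₀ α₁` and constants `c₀ γ₀ γ₁ δ₀ κt Bc R` with `κ₀(64,8) ≤ δ₀∕2 − 1`, `2γ₁ ≤ R`,
`2·(2c₀)·(64K₀(64,8))·e^{δ₀} ≤ R`: the TokE guard at some `ε₁ > 0` and the TokP9-reg shape at every member volume, carriers `(TC, TY, TZY, AdM, AdZ)` satisfying the P0-ℂ body, resolvent pieces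
`(EG, EGZ)` satisfying `G3CPiecesAt … κt Bc`, and an integer twin `ΨP` of the power member at radius `R` GIVE ONE integer formula `Ψ` and the torus pieces `Ew := lzdetTorusPieces … TY EG R` with
`Ψ.ResidueAtW F Mc k Ew a₀ ε₂₉ α₀ α₁ E₁ κ (phiLZdet F Mc a₀ ε₂₉ k)`, `E₁ = 2·13·4⁴·(R·Bc + 12(L·Mc)⁴)`, `κ = min κt (δ₀∕2) − 2` — rows (a)(b)(c)(d) at every domain, the off-wrap pieces =
the pull-back pieces of `Ψ`, and the (63) identity on the germ. [cite: Balaban1985UV3, (63) p.272, (23)–(25) p.262; Balaban1987RG1, (1.6)–(1.9) p.261, (1.18)–(1.19) p.263, (1.21) p.264, (2.11)–(2.14)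
pp.267–268; Balaban1985Variational, Prop. 9 p.309] -/
theorem lzdetResidue_of_carriers {Mc : ℕ} (hMc : McGuard F Mc) (k : ℕ) {a₀ ε₂₉ α₀ α₁ c₀ γ₀ γ₁ δ₀ κt Bc R : ℝ}
    (hα₀ : 0 < α₀) (hα₁ : 0 < α₁) (hc₀ : 0 < c₀) (hγ₁ : 0 < γ₁) (hBc : 0 ≤ Bc) (hR : 0 < R) (hR₁ : 2 * γ₁ ≤ R)
    (hδ : kappa₀ (4 * 2 ^ 4) (2 * 4) ≤ δ₀ / 2 - 1)
    (hRc : 2 * ((2 * c₀) * (4 * 2 ^ 4 * K₀ (4 * 2 ^ 4) (2 * 4)) * Real.exp δ₀) ≤ R)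
    {ε₁ : ℝ} (hε₁ : 0 < ε₁)
    (hTokE : ∀ (n : ℕ) (V : GaugeField (F.P (recordK₀ F Mc k + n)) (k + 1) (SU 2)), PlaqSmall ε₁ V →
      UkExists F 2 (recordK₀ F Mc k + n) (k + 1) a₀ V ∧ UniqueUkOrbit F 2 (recordK₀ F Mc k + n) (k + 1) a₀ V)
    (hP9 : ∀ n : ℕ, letI θ := thetaFill F a₀ ε₂₉; letI := θ.instVβ₁; letI := θ.instVβ₂; letI := θ.instιβ
      AnalyticAt ℝ (fun B : recordW F a₀ ε₂₉ k (recordK₀ F Mc k + n) => fun (b : PBond (F.P (recordK₀ F Mc k + n)) 0) (i i' : Fin 2) =>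
        ((recordBgField F θ k (recordK₀ F Mc k + n) B b : SU 2) : Matrix (Fin 2) (Fin 2) ℂ) i i') 0)
    (TC : (n : ℕ) → Sect2.CPair (F.P (recordK₀ F Mc k + n)) (MatA 2) → FluctIdx F k (recordK₀ F Mc k + n) → FluctIdx F k (recordK₀ F Mc k + n) → ℂ)
    (TY : (n : ℕ) → (recordDomSys F Mc k (recordK₀ F Mc k + n)).Dom → Sect2.CPair (F.P (recordK₀ F Mc k + n)) (MatA 2) →
        FluctIdx F k (recordK₀ F Mc k + n) → FluctIdx F k (recordK₀ F Mc k + n) → ℂ)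
    (TZY : Finset (Fin 4 → ℤ) → IntBondCfg → ((Fin 4 → ℤ) × Fin 4) × Fin 3 → ((Fin 4 → ℤ) × Fin 4) × Fin 3 → ℂ)
    (AdM : (n : ℕ) → (Site (F.P (recordK₀ F Mc k + n)) 0 → (MatA 2)ˣ) → Matrix (FluctIdx F k (recordK₀ F Mc k + n)) (FluctIdx F k (recordK₀ F Mc k + n)) ℂ)
    (AdZ : ((Fin 4 → ℤ) → (MatA 2)ˣ) → (Fin 4 → ℤ) × Fin 4 → Matrix (Fin 3) (Fin 3) ℂ)
    (hP : P0CarrierClauses F a₀ δ₀ c₀ γ₀ γ₁ Mc α₀ α₁ ε₂₉ k TC TY TZY AdM AdZ)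
    (EG : ℝ → (n : ℕ) → (recordDomSys F Mc k (recordK₀ F Mc k + n)).Dom → Sect2.CPair (F.P (recordK₀ F Mc k + n)) (MatA 2) → ℂ)
    (EGZ : ℝ → IntFormula) (hG : G3CPiecesAt F Mc k a₀ ε₂₉ α₀ α₁ κt Bc TC EG EGZ)
    (ΨP : IntLocalFormula (F.L ^ (k + 1) * Mc))
    (hΨP : ∀ (n : ℕ) (X : (recordDomSys F Mc k (recordK₀ F Mc k + n)).Dom), X ∉ recordWrapCtr F Mc k (recordK₀ F Mc k + n) →
      ∀ φ : Sect2.CPair (F.P (recordK₀ F Mc k + n)) (MatA 2),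
        ΨP.Ψ.piece F Mc k (recordK₀ F Mc k + n) X φ =
          powMemberPiece (fun Y : (recordDomSys F Mc k (recordK₀ F Mc k + n)).Dom =>
              (Y.1 : Finset (TPt (F.P (recordK₀ F Mc k + n)).d (Sect2.domCount (F.P (recordK₀ F Mc k + n)) Mc (k + 1)))))
            (fun Y => nonB0Block F k (recordK₀ F Mc k + n) (TY n Y φ)) R X.1) :
    ∃ (Ψ : IntLocalFormula (F.L ^ (k + 1) * Mc)) (Ew : TorusPieces F Mc k),
      Ψ.ResidueAtW F Mc k Ew a₀ ε₂₉ α₀ α₁ (2 * (13 * 4 ^ 4 * (R * Bc + ((3 * 4 * (F.L * Mc) ^ 4 : ℕ) : ℝ)))) (min κt (δ₀ / 2) - 2)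
        (phiLZdet F Mc a₀ ε₂₉ k) := by
  obtain ⟨hZsupp, hZdom, hZloc, hZcov, hZbr, hP2, hP3, hP4sum, hP4supp, hP4loc, hP4an, hP5, hP5c⟩ := hP
  obtain ⟨hg1, hg235, hg4, hg6, hgZ⟩ := hG
  -- constants
  have hc₀' : (0 : ℝ) ≤ c₀ := hc₀.le
  have hKc : 0 ≤ 4 * 2 ^ 4 * K₀ (4 * 2 ^ 4) (2 * 4) := by have := B12TreeDecay.K₀_pos (4 * 2 ^ 4) (2 * 4); positivity
  have hRc₁ : 2 * (c₀ * (4 * 2 ^ 4 * K₀ (4 * 2 ^ 4) (2 * 4)) * Real.exp δ₀) ≤ R := by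
    have : c₀ * (4 * 2 ^ 4 * K₀ (4 * 2 ^ 4) (2 * 4)) * Real.exp δ₀ ≤ (2 * c₀) * (4 * 2 ^ 4 * K₀ (4 * 2 ^ 4) (2 * 4)) * Real.exp δ₀ := by
      nlinarith [mul_nonneg hKc (Real.exp_nonneg δ₀), hc₀']
    linarith
  have hK : ∀ n : ℕ, recordK₀ F Mc k ≤ recordK₀ F Mc k + n := fun n => Nat.le_add_right _ _
  have hdj : ∀ (n : ℕ) (Y : (recordDomSys F Mc k (recordK₀ F Mc k + n)).Dom), (recordDomSys F Mc k (recordK₀ F Mc k + n)).dj Y =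
      torusTreeLen (Y.1 : Finset (TPt (F.P (recordK₀ F Mc k + n)).d (Sect2.domCount (F.P (recordK₀ F Mc k + n)) Mc (k + 1)))) := fun _ _ => rfl
  -- the cube map and the support of the pieces in cube form
  have hsupp : ∀ (n : ℕ) Y φ (s s' : NonB0Idx F k (recordK₀ F Mc k + n)),
      (cubeOfSite F Mc k (recordK₀ F Mc k + n) (blockOf s.1.1.src) ∉ (Y.1 : Finset (TPt (F.P (recordK₀ F Mc k + n)).d (Sect2.domCount (F.P (recordK₀ F Mc k + n)) Mc (k + 1)))) ∨
        cubeOfSite F Mc k (recordK₀ F Mc k + n) (blockOf s'.1.1.src) ∉ (Y.1 : Finset (TPt (F.P (recordK₀ F Mc k + n)).d (Sect2.domCount (F.P (recordK₀ F Mc k + n)) Mc (k + 1))))) →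
        TY n Y φ s.1 s'.1 = 0 :=
    fun n Y φ s s' h => fluct_supp_of_cube hMc (hK n) (hP4supp n) Y φ s s' h
  have hV : ∀ (n : ℕ) q, (univ.filter fun s : NonB0Idx F k (recordK₀ F Mc k + n) => cubeOfSite F Mc k (recordK₀ F Mc k + n) (blockOf s.1.1.src) = q).card ≤ 3 * 4 * (F.L * Mc) ^ 4 :=
    fun n q => card_filter_cube_le hMc (hK n) q
  -- operator-norm decay of the non-b₀ blocks from (P4)'s Schur decay
  have hTYop : ∀ (n : ℕ) (Y : (recordDomSys F Mc k (recordK₀ F Mc k + n)).Dom) φ, encodeCfg F (recordK₀ F Mc k + n) φ ∈ recordUc F Mc k α₀ α₁ (recordK₀ F Mc k + n) Y →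
      ‖nonB0Block F k (recordK₀ F Mc k + n) (TY n Y φ)‖ ≤ c₀ * Real.exp (-(δ₀ * torusTreeLen (Y.1 : Finset (TPt (F.P (recordK₀ F Mc k + n)).d (Sect2.domCount (F.P (recordK₀ F Mc k + n)) Mc (k + 1)))))) := by
    intro n Y φ hφ
    obtain ⟨-, hrow, hcol⟩ := hP4an n Y φ hφ
    rw [← hdj]
    exact norm_nonB0Block_le_of_schur F k _ (TY n Y φ) (by positivity) hrow hcol
  -- the unit pair lies in every record space
  have hunit : ∀ (n : ℕ) (X : (recordDomSys F Mc k (recordK₀ F Mc k + n)).Dom),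
      encodeCfg F (recordK₀ F Mc k + n) (unitCPair F (recordK₀ F Mc k + n)) ∈ recordUc F Mc k α₀ α₁ (recordK₀ F Mc k + n) X := by
    intro n X
    have h := encodeCfg_unitPair_mem_recordUc F Mc k (recordK₀ F Mc k + n) X hα₀ hα₁
    rwa [embedPair_unitPair] at h
  -- §1: the integer formula
  set unitZ : IntBondCfg := fun _ => (1, 0) with hunitZ
  set ΨG : IntFormula := fun Xh f => (1 / 2 : ℂ) * (∫ x in (0 : ℝ)..R, EGZ x Xh f) + ΨP.Ψ Xh f with hΨG
  have hΨGloc : IntFormula.IsLocal (F.L ^ (k + 1) * Mc) ΨG := isLocal_lzdetGFormula EGZ ΨP hR.le fun x hx => (hgZ x hx).1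
  have hΨGinv : IntFormula.IsGaugeInv ΨG := isGaugeInv_lzdetGFormula EGZ ΨP hR.le fun x hx => (hgZ x hx).2.1
  let Ψ : IntLocalFormula (F.L ^ (k + 1) * Mc) := ⟨fun Xh f => ΨG Xh f - ΨG Xh unitZ, isLocal_subUnit _ ΨG hΨGloc, isGaugeInv_subUnit ΨG hΨGinv⟩
  -- the unsubtracted torus piece IS `ΨG` read through the cover, off the wrap class
  have hGpiece : ∀ (n : ℕ) (X : (recordDomSys F Mc k (recordK₀ F Mc k + n)).Dom), X ∉ recordWrapCtr F Mc k (recordK₀ F Mc k + n) →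
      ∀ ψ, ΨG (intCubes F Mc k (recordK₀ F Mc k + n) X) (pullPair F (recordK₀ F Mc k + n) ψ) = lzdetGPiece F Mc k (recordK₀ F Mc k + n) (TY n) (fun x => EG x n) R X ψ := by
    intro n X hX ψ
    have hint : (∫ x in (0 : ℝ)..R, EGZ x (intCubes F Mc k (recordK₀ F Mc k + n) X) (pullPair F (recordK₀ F Mc k + n) ψ)) = ∫ x in (0 : ℝ)..R, EG x n X ψ :=
      intervalIntegral.integral_congr fun x hx => by
        rw [Set.uIcc_of_le hR.le] at hx
        exact (hgZ x hx.1).2.2 n X hX ψ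
    show (1 / 2 : ℂ) * (∫ x in (0 : ℝ)..R, EGZ x _ _) + ΨP.Ψ _ _ = _
    rw [hint]
    unfold lzdetGPiece
    congr 1
    exact hΨP n X hX ψ
  refine ⟨Ψ, lzdetTorusPieces F Mc k TY EG R, residueAtW_of_piecesJ F Mc k a₀ ε₂₉ α₀ α₁ _ _ Ψ _ _ ?_ ?_ ?_ ?_ ?_ ?_⟩
  · -- off-wrap pieces = pull-back pieces of Ψ
    intro n X hX φ
    show lzdetPiece F Mc k (recordK₀ F Mc k + n) (TY n) (fun x => EG x n) R X φ =
      ΨG (intCubes F Mc k (recordK₀ F Mc k + n) X) (pullPair F (recordK₀ F Mc k + n) φ) - ΨG (intCubes F Mc k (recordK₀ F Mc k + n) X) unitZ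
    have hu : unitZ = pullPair F (recordK₀ F Mc k + n) (unitCPair F (recordK₀ F Mc k + n)) := rfl
    rw [hu, hGpiece n X hX, hGpiece n X hX]
    rfl
  · -- row (a)
    intro n X φ hφ
    obtain ⟨O, hO, hOsub, hx, hcont⟩ := hg235 n X
    exact analyticAt_lzdetPiece F Mc k (recordK₀ F Mc k + n) (TY n) (fun x => EG x n) (fun s => cubeOfSite F Mc k (recordK₀ F Mc k + n) (blockOf s.1.1.src))
      hR hc₀ hδ hRc (hsupp n) X hO (fun ψ hψ => hOsub hψ) (fun x hx' => (hx x hx').1) (fun x hx' ψ hψ => (hx x hx').2 ψ hψ) hcont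
      (fun Y ψ hψ => (hP4an n Y ψ hψ).1) (fun Y ψ hψ => (hP4an n Y ψ hψ).2.1) (fun Y ψ hψ => (hP4an n Y ψ hψ).2.2) φ hφ
  · -- row (b)
    intro n X φ hφ
    obtain ⟨O, hO, hOsub, hx, hcont⟩ := hg235 n X
    have hmem : ∀ ψ ∈ ({φ, unitCPair F (recordK₀ F Mc k + n)} : Set (Sect2.CPair (F.P (recordK₀ F Mc k + n)) (MatA 2))),
        encodeCfg F (recordK₀ F Mc k + n) ψ ∈ recordUc F Mc k α₀ α₁ (recordK₀ F Mc k + n) X := by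
      intro ψ hψ
      rcases hψ with rfl | hψ
      · exact hφ
      · rw [Set.mem_singleton_iff] at hψ; rw [hψ]; exact hunit n X
    have h := norm_lzdetPiece_le F Mc k (recordK₀ F Mc k + n) (TY n) (fun x => EG x n) (fun s => cubeOfSite F Mc k (recordK₀ F Mc k + n) (blockOf s.1.1.src))
      hR hBc hc₀' hδ hRc₁ (hsupp n) (hV n) X φ
      (fun ψ hψ x hx' => (hx x hx'.1).2 ψ (hOsub (hmem ψ hψ)))
      (fun ψ hψ Y hY => hTYop n Y ψ (recordUc_anti F Mc k α₀ α₁ _ hY (hmem ψ hψ)))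
    rw [neg_mul]
    exact h
  · -- row (c)
    intro n X φ ψ hag
    exact lzdetPiece_congr_of_agreeOnSet F Mc k (recordK₀ F Mc k + n) (TY n) (fun x => EG x n) R X (hP4loc n) (fun x φ' ψ' h => hg4 x n X φ' ψ' h) hag
  · -- row (d)
    intro n X u φ
    obtain ⟨hU, hdiag, hcov⟩ := hP3 n u.1
    exact lzdetPiece_cAct F Mc k (recordK₀ F Mc k + n) (TY n) (fun x => EG x n) R X u.1 (AdM n u.1) hU hdiag hcov (fun x φ' => hg6 x n X u.1 φ') φ
  · -- the (63) identity on the germ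
    intro n
    letI θ := thetaFill F a₀ ε₂₉; letI := θ.instVβ₁; letI := θ.instVβ₂; letI := θ.instιβ
    have hmem := eventually_encodeCfg_recordPairJ_mem_recordUc_at F a₀ ε₂₉ Mc k n (hP9 n) hα₀ hα₁
    have hSchur : ∀ᶠ B in 𝓝 (0 : recordW F a₀ ε₂₉ k (recordK₀ F Mc k + n)), ∀ Y,
        ‖nonB0Block F k (recordK₀ F Mc k + n) (TY n Y (recordPairJ F θ k (recordK₀ F Mc k + n) B))‖ ≤
          c₀ * Real.exp (-(δ₀ * torusTreeLen (Y.1 : Finset (TPt (F.P (recordK₀ F Mc k + n)).d (Sect2.domCount (F.P (recordK₀ F Mc k + n)) Mc (k + 1)))))) := by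
      filter_upwards [hmem] with B hB Y using hTYop n Y _ (hB Y)
    have hcont' : ∀ᶠ B in 𝓝 (0 : recordW F a₀ ε₂₉ k (recordK₀ F Mc k + n)), ∀ X,
        ContinuousOn (fun x : ℝ => EG x n X (recordPairJ F θ k (recordK₀ F Mc k + n) B)) (Set.Icc 0 R) := by
      filter_upwards [hmem] with B hB X
      obtain ⟨O, hO, hOsub, hx, hcont⟩ := hg235 n X
      exact (hcont _ (hOsub (hB X))).mono Set.Icc_subset_Ici_self
    exact eventually_phiLZdet_eq_sum_lzdetPiece F Mc a₀ ε₂₉ k n hε₁ (hTokE n) (hP9 n) (TC n) (TY n) (fun x => EG x n)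
      (fun s => cubeOfSite F Mc k (recordK₀ F Mc k + n) (blockOf s.1.1.src)) hγ₁ hc₀' hδ hR₁ hRc₁ (hP2 n) (hP5 n) (hP4sum n) (hsupp n) hSchur (hg1 n) hcont'

end Assembly

end Summit.QuantumFields.YangMills.Theorems.BalabanUVNodesPortS1

end
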